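import Literature.Probability.Percolation.ArmSeparationOutMove
import HarnessLib

/-!
# The outer landing moves to the four box-preserving sides (landing pattern `0, 2, 3, 5`)

Topic `Literature/Probability/Percolation`; family `crit-perc` / near-critical percolation on `𝕋`.
A brick of the near-critical arm-separation theorem for four arms of alternating colours
(P. Nolin, *Near-critical percolation in two dimensions*, EJP 13 (2008), Thm. 11 for `j = 4`,
`σ = BWBW` [arXiv 0711.4948: Thm. 10], landing step of the external extremities, §4.4 p. 12 with
Prop. 12 (i) [arXiv Prop. 11]; H. Kesten, CMP 109 (1987), Lemma 2). The tree's outer landing move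
`out_landing_move` (`ArmSeparationOutMove.lean`) carries ONE tiny-fenced outer tip through beacon,
spoke, ring arc, approach tube and target free space to a landing on the RIGHT side of `∂Λ_{4M}` at
one of two fixed target rows. For four arms landing on the sides `0, 2, 3, 5`
(`ArmSeparationExtFourArmQ.lean`) two generalisations are needed, proved here:

* an arbitrary target row `t` of the landing zone (`out_landing_move_row`: the same proof, the
  row `otgtRow (4M) b` replaced by any `t` with `-2M + 4M/16 ≤ t ≤ -M - 4M/16`), so that the target
  rows of the four arms can dodge each other's tips;
* landing on the TOP side `2` (`out_landing_move_two`): the corridor is the same up to the exit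
  run, which now consists of the pieces of the side `x₁ = r` of the ring, followed by a vertical
  approach tube up to beyond `{x₁ = 4M}` and a horizontal crossing of the transposed free space;
  the conclusion is that the transposed configuration `frameConfig 2 χ` (`frameIso 2 = σ`, the
  transposition `(x₀, x₁) ↦ (x₁, x₀)`, an automorphism of `𝕋`) has an open arm landed on its right
  side, `frameConfig 2 χ ∈ extOpenArm n (4M)`. The proof transports tubes, chains of tubes and
  their crossings through `σ` (`Tube.swap` and its API) and applies the tree's `out_landing_glue`
  in the transposed configuration (`out_landing_glue_two`); only paths and tubes are transported,
  never the fenced arm (whose frame need not be conjugate to a frame under `σ`).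

The sides `3`, `5` are the sides `0`, `2` of the centrally reflected configuration
`frameConfig 3 χ`, along which fenced arms CAN be transported (`compl_frameConfig_eq`,
`TrapFencedArm.transport`, as in the tree's `out_white_landing_move`); this is done where the moves
are used. Everything here is proved; no named facts are introduced.

## References

* P. Nolin, Near-critical percolation in two dimensions, *Electron. J. Probab.* 13 (2008), §4.2
  Def. 6–8, §4.3 Prop. 12, §4.4 (arXiv 0711.4948: Def. 6–8, Prop. 11, proof of Thm. 10, p. 12) [Nolin2008].
* H. Kesten, Scaling relations for 2D-percolation, *Comm. Math. Phys.* 109 (1987), Lemma 2 [Kesten1987].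

Tree: `out_landing_glue`, `otgtV`, `otgtHStrip_subset`, `otgtVStrip_subset_sepOuterFence`
(`ArmSeparationOutMove.lean`); `out_arm_to_entry`, `ospokeTube`, `ospokeEvent`, `obcnCentre`,
`otipBox`, `norm_mem_of_mem_ospokeBox`, `norm_mem_of_mem_otipBox` (`ArmSeparationOutCatch.lean`);
`Tube`, `Crosses`, `IsCrossing`, `chain_paths'`, `exists_crossings`, `arc`, `thinRing`, `vchunks`,
`isChain_arc_thinRing`, `mem_of_mem_arc`, `triNorm_mem_of_mem_thinRing`; `frameIso`, `frameConfig`,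
`pathIn_frameConfig`, `frameIso_apply_formula`, `frameIso_symm_apply_formula`, `triNorm_frameIso`;
`extOpenArm`, `sepLanding`, `TrapFencedArm`, `SpokeMeets`.
-/

noncomputable section

open Set

namespace Literature.Probability.Percolation

open LatticeModels Tube

/-! ### Transposition of tubes -/

namespace Tube

/-- **The transposed tube** `σ(T)`: columns and rows exchanged, crossed in the other direction. [folklore] -/
def swap (T : Tube) : Tube := ⟨T.b, T.a, T.h, T.w, !T.horiz⟩

/-- Fields of `σ(T)`. [folklore] -/
@[simp] theorem swap_a (T : Tube) : T.swap.a = T.b := rfl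
/-- Fields of `σ(T)`. [folklore] -/
@[simp] theorem swap_b (T : Tube) : T.swap.b = T.a := rfl
/-- Fields of `σ(T)`. [folklore] -/
@[simp] theorem swap_w (T : Tube) : T.swap.w = T.h := rfl
/-- Fields of `σ(T)`. [folklore] -/
@[simp] theorem swap_h (T : Tube) : T.swap.h = T.w := rfl
/-- Fields of `σ(T)`. [folklore] -/
@[simp] theorem swap_horiz (T : Tube) : T.swap.horiz = !T.horiz := rfl

/-- `σ` is an involution on tubes. [folklore] -/
@[simp] theorem swap_swap (T : Tube) : T.swap.swap = T := by
  cases T; simp [swap]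

/-- The box of `σ(T)` is the transposed box. [folklore] -/
theorem mem_box_swap {T : Tube} {v : Site 2} : v ∈ T.swap.box ↔ frameIso 2 v ∈ T.box := by
  obtain ⟨-, -, -, -, f0, f1, -⟩ := frameIso_apply_formula v
  rw [Tube.mem_box, Tube.mem_box, f0, f1]
  simp only [swap_a, swap_b, swap_w, swap_h]
  tauto

/-- `Crosses` is invariant under the transposition. [folklore] -/
theorem crosses_swap {T T' : Tube} (h : Crosses T T') : Crosses T.swap T'.swap := by
  rcases h with ⟨h1, h2, h3, h4, h5, h6⟩ | ⟨h1, h2, h3, h4, h5, h6⟩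
  · refine Or.inr ⟨by simp [h1], by simp [h2], ?_, ?_, ?_, ?_⟩ <;> simp only [swap_a, swap_b, swap_w, swap_h] <;> omega
  · refine Or.inl ⟨by simp [h1], by simp [h2], ?_, ?_, ?_, ?_⟩ <;> simp only [swap_a, swap_b, swap_w, swap_h] <;> omega

/-- A chain of crossing tubes stays one under the transposition. [folklore] -/
theorem isChain_map_swap {L : List Tube} (h : List.IsChain Crosses L) : List.IsChain Crosses (L.map swap) :=
  List.isChain_map_of_isChain swap (fun _ _ hab => crosses_swap hab) h

/-- Membership in a transposed list. [folklore] -/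
theorem mem_map_swap_iff {L : List Tube} {T : Tube} : T ∈ L.map swap ↔ T.swap ∈ L := by
  rw [List.mem_map]
  constructor
  · rintro ⟨U, hU, rfl⟩; rw [swap_swap]; exact hU
  · intro h; exact ⟨T.swap, h, swap_swap T⟩

end Tube

/-- The transposition is its own inverse: `(frameIso 2)⁻¹ = frameIso 2` pointwise. [folklore] -/
theorem frameIso_two_symm_apply (v : Site 2) : (frameIso 2).symm v = frameIso 2 v := by
  obtain ⟨-, -, -, -, a0, a1, -⟩ := frameIso_symm_apply_formula v
  obtain ⟨-, -, -, -, b0, b1, -⟩ := frameIso_apply_formula v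
  exact Site.eq_iff_two.2 ⟨by rw [a0, b0], by rw [a1, b1]⟩

/-- The transposition is an involution. [folklore] -/
theorem frameIso_two_two' (v : Site 2) : frameIso 2 (frameIso 2 v) = v := by
  rw [← frameIso_two_symm_apply]; exact (frameIso 2).symm_apply_apply v

namespace Tube

/-- **Crossings transpose**: a crossing of `T` in `ψ` is carried by `σ` to a crossing of `σ(T)` in
the transposed configuration `frameConfig 2 ψ`. [folklore] -/
theorem isCrossing_swap {T : Tube} {ψ : SiteConfig (Site 2)} {x y : Site 2} (h : T.IsCrossing ψ x y) :
    T.swap.IsCrossing (frameConfig 2 ψ) (frameIso 2 x) (frameIso 2 y) := by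
  obtain ⟨hs, hp⟩ := h
  obtain ⟨-, -, -, -, fx0, fx1, -⟩ := frameIso_apply_formula x
  obtain ⟨-, -, -, -, fy0, fy1, -⟩ := frameIso_apply_formula y
  refine ⟨?_, ?_⟩
  · cases hT : T.horiz
    · rw [hT] at hs; simp only [cond_false] at hs
      simp only [swap_horiz, hT, Bool.not_false, cond_true, swap_a, swap_w, fx0, fy0]
      exact hs
    · rw [hT] at hs; simp only [cond_true] at hs
      simp only [swap_horiz, hT, Bool.not_true, cond_false, swap_b, swap_h, fx1, fy1]
      exact hs
  · have hp' : PathIn triGraph (T.box ∩ {v | v ∈ ψ ↔ true}) x y := hp.mono fun v hv => ⟨hv.1, by simpa using hv.2⟩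
    have q := pathIn_frameConfig 2 hp'
    rw [frameIso_two_symm_apply, frameIso_two_symm_apply] at q
    refine q.mono ?_
    rintro w ⟨⟨v, hv, rfl⟩, hw⟩
    refine ⟨?_, by simpa using hw⟩
    rw [show ((frameIso 2).symm : triGraph ≃g triGraph) v = (frameIso 2).symm v from rfl, frameIso_two_symm_apply, mem_box_swap,
      frameIso_two_two']
    exact hv

/-- **Crossing events transpose**: if `ψ` crosses `T`, then `frameConfig 2 ψ` crosses `σ(T)`. [folklore] -/
theorem event_swap {T : Tube} {ψ : SiteConfig (Site 2)} (h : ψ ∈ T.event) : frameConfig 2 ψ ∈ T.swap.event := by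
  obtain ⟨x, y, hxy⟩ := T.exists_isCrossing h
  obtain ⟨hs, hp⟩ := isCrossing_swap hxy
  unfold event
  cases hT : T.swap.horiz
  · rw [hT] at hs; simp only [cond_false] at hs ⊢
    exact ⟨_, _, hs.1, hs.2, hp⟩
  · rw [hT] at hs; simp only [cond_true] at hs ⊢
    exact ⟨_, _, hs.1, hs.2, hp⟩

end Tube

/-! ### Landing on the top side: the glue, transposed -/

/-- **Outer landing glue on the top side.** In a configuration `ψ`, let the inner end `a₀` (norm
`n`) of an arm be joined, inside a region `R₁ ⊆ σ({n ≤ |v| ≤ N'} ∪ S̊_{N'/8}(N', t))`, to the start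
`X Te` of the crossing of a tube `Te` of a chain `E :: L` of tubes all crossed by `ψ`, inside the
annulus, and containing the TRANSPOSES of the run `V_{j₀}, …, V_{j₀+d}` of the right side (i.e. the
pieces of the top side `x₁ = r` over the columns `[t, t + N'/64]`). If the transposed configuration
`frameConfig 2 ψ` crosses the approach tube `[r - 2e, N' + N'/16] × [t, t + N'/64]` horizontally and
the thinned target free space at the row `t` vertically (i.e. `ψ` crosses the vertical approach tube
`[t, t + N'/64] × [r - 2e, N' + N'/16]` vertically and the transposed free space horizontally), then
`frameConfig 2 ψ ∈ extOpenArm n N'`: `out_landing_glue` in the transposed configuration, all tubes,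
crossings and paths being carried over by `σ`. [cite: Nolin2008, §4.3 Prop. 12 (proof) (arXiv 0711.4948: Prop. 11)] -/
theorem out_landing_glue_two {n N' : ℕ} {ψ : SiteConfig (Site 2)} {t : ℤ} (ht : -(N' : ℤ) ≤ t ∧ t + (N' / 64 : ℕ) ≤ 0)
    (hland : (![(N' : ℤ), t] : Site 2) ∈ sepLanding N')
    {E : Tube} {L : List Tube} (hch : List.IsChain Crosses (E :: L)) {X Y : Tube → Site 2}
    (hXY : ∀ T ∈ E :: L, T.IsCrossing ψ (X T) (Y T)) (hLreg : ∀ T ∈ E :: L, T.box ⊆ triAnnulusSet n N')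
    {R₁ : Set (Site 2)} (hR₁ : R₁ ⊆ frameIso 2 '' (triAnnulusSet n N' ∪ triOpenBall ![(N' : ℤ), t] (N' / 8))) {Te : Tube} (hTe : Te ∈ E :: L)
    {a₀ : Site 2} (ha₀ : triNorm a₀ = n) (P₁ : PathIn triGraph (R₁ ∩ ψ) a₀ (X Te))
    {r e s j₀ d : ℕ} (hSL : ∀ T ∈ vchunks r (-(r : ℤ)) e s j₀ (d + 1), T.swap ∈ E :: L)
    (hlo : -(r : ℤ) + j₀ * s - e ≤ t) (hhi : t + (N' / 64 : ℕ) ≤ -(r : ℤ) + (j₀ + d) * s - e)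
    (hnr : (n : ℤ) ≤ (r : ℤ) - 2 * e) (he : 2 * e ≤ r) {W : ℕ} (hW : (r : ℤ) - 2 * e + W = N' + (N' / 16 : ℕ))
    (hH : frameConfig 2 ψ ∈ triHCross ((r : ℤ) - 2 * e) t W (N' / 64)) (hV : frameConfig 2 ψ ∈ otgtV N' t) (hN' : 64 ≤ N')
    (hrN : (r : ℤ) + e ≤ N') :
    frameConfig 2 ψ ∈ extOpenArm n N' := by
  -- the transposed chain and its crossings
  have hch' : List.IsChain Crosses (E.swap :: L.map swap) := by
    have := isChain_map_swap hch; simpa using this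
  have hmem : ∀ T, T ∈ E.swap :: L.map swap ↔ T.swap ∈ E :: L := fun T => by
    rw [List.mem_cons, List.mem_cons, mem_map_swap_iff]
    constructor
    · rintro (rfl | h)
      · left; exact swap_swap E
      · right; exact h
    · rintro (h | h)
      · left; rw [← h, swap_swap]
      · right; exact h
  have hXY' : ∀ T ∈ E.swap :: L.map swap, T.IsCrossing (frameConfig 2 ψ) (frameIso 2 (X T.swap)) (frameIso 2 (Y T.swap)) := fun T hT => by
    have h := isCrossing_swap (hXY T.swap ((hmem T).1 hT))
    rw [swap_swap] at h
    exact h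
  have hLreg' : ∀ T ∈ E.swap :: L.map swap, T.box ⊆ triAnnulusSet n N' := fun T hT v hv => by
    have hv' : frameIso 2 v ∈ T.swap.box := by rw [← swap_swap T, mem_box_swap] at hv; exact hv
    have := hLreg T.swap ((hmem T).1 hT) hv'
    rw [mem_triAnnulusSet, triNorm_frameIso 2 (by norm_num)] at this
    rw [mem_triAnnulusSet]; exact this
  -- the arm, transposed
  have P₁' : PathIn triGraph (((frameIso 2).symm '' R₁) ∩ frameConfig 2 ψ) (frameIso 2 a₀) (frameIso 2 (X Te.swap.swap)) := by
    have hp' : PathIn triGraph (R₁ ∩ {v | v ∈ ψ ↔ true}) a₀ (X Te) := P₁.mono fun v hv => ⟨hv.1, by simpa using hv.2⟩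
    have q := pathIn_frameConfig 2 hp'
    rw [frameIso_two_symm_apply, frameIso_two_symm_apply] at q
    rw [swap_swap]
    exact q.mono fun v hv => ⟨hv.1, hv.2.2 rfl⟩
  have hR₁' : (frameIso 2).symm '' R₁ ⊆ triAnnulusSet n N' ∪ triOpenBall ![(N' : ℤ), t] (N' / 8) := by
    rintro w ⟨v, hv, rfl⟩
    obtain ⟨u, hu, huv⟩ := hR₁ hv
    rw [← huv, RelIso.symm_apply_apply]
    exact hu
  have ha₀' : triNorm (frameIso 2 a₀) = n := by rw [triNorm_frameIso 2 (by norm_num), ha₀]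
  have hTe' : Te.swap ∈ E.swap :: L.map swap := (hmem _).2 (by rw [swap_swap]; exact hTe)
  have hSL' : ∀ T ∈ vchunks r (-(r : ℤ)) e s j₀ (d + 1), T ∈ E.swap :: L.map swap := fun T hT => (hmem T).2 (hSL T hT)
  exact out_landing_glue (χ := frameConfig 2 ψ) ht hland hch' (X := fun T => frameIso 2 (X T.swap)) (Y := fun T => frameIso 2 (Y T.swap))
    hXY' hLreg' hR₁' hTe' ha₀' P₁' hSL' hlo hhi hnr he hW hH hV hN' hrN

/-! ### The moves -/

/-- The middle-half target rows of the right side of `∂Λ_{4M}` used by the four-arm landing,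
`-2M + 4M/16 ≤ t ≤ -M - 4M/16`, are landing rows: `(4M, t) ∈ sepLanding (4M)`, `-4M ≤ t` and
`t + 4M/64 ≤ 0`. [cite: Nolin2008, §4.2 Def. 8 (arXiv 0711.4948)] -/
theorem tgtRow_facts {M : ℕ} {t : ℤ} (ht : -(2 * (M : ℤ)) + (4 * M / 16 : ℕ) ≤ t ∧ t ≤ -(M : ℤ) - (4 * M / 16 : ℕ)) :
    (![((4 * M : ℕ) : ℤ), t] : Site 2) ∈ sepLanding (4 * M) ∧ -((4 * M : ℕ) : ℤ) ≤ t ∧ t + ((4 * M) / 64 : ℕ) ≤ 0 := by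
  rw [mem_sepLanding, site_mk_apply_zero, site_mk_apply_one]
  refine ⟨⟨rfl, ?_, ?_⟩, ?_, ?_⟩ <;> push_cast <;> omega

/-- **The outer landing move to the right side at an arbitrary middle target row.** As the tree's
`out_landing_move` (fenced outer arm `Fo` of `χ` in the frame `i` with a middle tip, tip row in the
window `[T₀, T₀ + w)`; beacon, spoke, an arc of the thin ring of radius `r` all crossed and containing a
tube met by the spoke and the run `V_{j₀}, …, V_{j₀+d}` across the rows `[t, t + 4M/64]`; approach
tube and thinned target free space at the row `t` crossed; size conditions), with the target row any
`t` such that `-2M + 4M/16 ≤ t ≤ -M - 4M/16`. Then `χ ∈ extOpenArm n (4M)`. [cite: Nolin2008, §4.3 Prop. 12 and §4.4 (arXiv 0711.4948: Prop. 11, Thm. 10, p. 12)] -/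
theorem out_landing_move_row {M n k₀ K R₀ : ℕ} (hnM : n ≤ M) {i : ℕ} (hi : i < 6) {χ : SiteConfig (Site 2)}
    (Fo : TrapFencedArm M n k₀ K (frameConfig i χ)) (hmid : -(2 * (M : ℤ)) + R₀ ≤ Fo.z 1 ∧ Fo.z 1 ≤ -(R₀ : ℤ))
    (hR : 4 * Fo.k + 2 ≤ R₀)
    {T₀ : ℤ} {w : ℕ} (hwk : 4 * w ≤ Fo.k) (hk : 4 ≤ Fo.k) (hwin : T₀ ≤ Fo.z 1 ∧ Fo.z 1 < T₀ + w)
    (hB : frameConfig i χ ∈ triFrameAt (obcnCentre M Fo.k T₀ w) (Fo.k / 2))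
    {L ε : ℕ} (hε : 4 * ε ≤ Fo.k) (hL : 2 * Fo.k ≤ L) (hSp : χ ∈ ospokeEvent i M Fo.k T₀ w L ε)
    {r e s a len : ℕ} (hs : 1 ≤ s) (hsr : s ∣ r) (hsr' : s ≤ r) (he : 2 * e ≤ r)
    (harc : χ ∈ eventAll (arc (thinRing r e s) a len))
    {Te : Tube} (hTe : Te ∈ arc (thinRing r e s) a len) (hJ : SpokeMeets i (ospokeTube M Fo.k T₀ w L ε) Te)
    {t : ℤ} (ht : -(2 * (M : ℤ)) + (4 * M / 16 : ℕ) ≤ t ∧ t ≤ -(M : ℤ) - (4 * M / 16 : ℕ))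
    {j₀ d : ℕ} (hSL : ∀ T ∈ vchunks r (-(r : ℤ)) e s j₀ (d + 1), T ∈ arc (thinRing r e s) a len)
    (hlo : -(r : ℤ) + j₀ * s - e ≤ t) (hhi : t + (4 * M / 64 : ℕ) ≤ -(r : ℤ) + (j₀ + d) * s - e)
    {W : ℕ} (hW : (r : ℤ) - 2 * e + W = 4 * M + (4 * M / 16 : ℕ))
    (hH : χ ∈ triHCross ((r : ℤ) - 2 * e) t W (4 * M / 64)) (hV : χ ∈ otgtV (4 * M) t)
    (hM : 64 ≤ M) (hkL : 2 * (Fo.k : ℤ) + L ≤ 2 * M) (hr2 : 2 * (M : ℤ) < (r : ℤ) - s - 2 * e) (hr4 : (r : ℤ) + 2 * e ≤ 4 * M) :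
    χ ∈ extOpenArm n (4 * M) := by
  have hwk' : 4 * (w : ℤ) ≤ Fo.k := by exact_mod_cast hwk
  have hε' : 4 * (ε : ℤ) ≤ Fo.k := by exact_mod_cast hε
  have hR' : 4 * (Fo.k : ℤ) + 2 ≤ R₀ := by exact_mod_cast hR
  have hnM' : (n : ℤ) ≤ M := by exact_mod_cast hnM
  obtain ⟨hz0, hz1, hz2⟩ := trapO_coord Fo.z_mem
  obtain ⟨hm1, hm2⟩ := hmid
  have ht4 : Fo.z 1 + 4 * Fo.k + 2 ≤ 0 := by omega
  obtain ⟨hland, htr1, htr2⟩ := tgtRow_facts ht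
  -- the arc as a nonempty chain with prescribed crossings
  obtain ⟨E, L', hEL⟩ := List.exists_cons_of_ne_nil (List.ne_nil_of_mem hTe)
  have harc' : ∀ T ∈ E :: L', χ ∈ T.event := fun T hT => harc T (hEL ▸ hT)
  have hch : List.IsChain Crosses (E :: L') := hEL ▸ isChain_arc_thinRing hs hsr hsr' a len
  obtain ⟨X, Y, hXY⟩ := exists_crossings harc'
  have hTe' : Te ∈ E :: L' := hEL ▸ hTe
  have hring : ∀ T ∈ E :: L', T ∈ thinRing r e s := fun T hT => mem_of_mem_arc (hEL ▸ hT : T ∈ arc (thinRing r e s) a len)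
  have hLreg : ∀ T ∈ E :: L', T.box ⊆ triAnnulusSet n (4 * M) := fun T hT v hv => by
    have := triNorm_mem_of_mem_thinRing he (hring T hT) hv
    rw [mem_triAnnulusSet]; push_cast; constructor <;> omega
  -- the hook
  have P₁ := out_arm_to_entry hnM hi Fo hwk hk hwin ht4 hB hε hL hSp (hXY Te hTe') hJ
  -- everything lies in the arm region
  have hreg : frameIso i '' ((ospokeTube M Fo.k T₀ w L ε).box ∪ (triAnnSet n (2 * M) ∪ otipBox M (Fo.z 1) Fo.k)) ∪ Te.box ⊆
      triAnnulusSet n (4 * M) ∪ triOpenBall ![((4 * M : ℕ) : ℤ), t] (4 * M / 8) := by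
    have hann : ∀ v : Site 2, (n : ℤ) ≤ triNorm v → triNorm v ≤ 4 * M →
        v ∈ triAnnulusSet n (4 * M) ∪ triOpenBall ![((4 * M : ℕ) : ℤ), t] (4 * M / 8) :=
      fun v h1 h2 => Or.inl ⟨h1, by push_cast; exact h2⟩
    rintro v (⟨u, hu, rfl⟩ | hv)
    · rcases hu with hu | hu | hu
      · have := norm_mem_of_mem_ospokeBox hk hε (T₀ := T₀) (w := w) (L := L) (M := M) (by omega) (by omega) hu
        exact hann _ (by rw [triNorm_frameIso i hi]; omega) (by rw [triNorm_frameIso i hi]; omega)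
      · rw [mem_triAnnSet] at hu
        exact hann _ (by rw [triNorm_frameIso i hi]; exact hu.1) (by rw [triNorm_frameIso i hi]; push_cast at hu; omega)
      · have := norm_mem_of_mem_otipBox (k := Fo.k) (by omega) (by omega) hu
        exact hann _ (by rw [triNorm_frameIso i hi]; omega) (by rw [triNorm_frameIso i hi]; omega)
    · have := hLreg Te hTe' hv
      rw [mem_triAnnulusSet] at this
      push_cast at this
      exact hann v this.1 this.2
  -- glue
  have hna : triNorm (frameIso i Fo.a) = n := by rw [triNorm_frameIso i hi, Fo.norm_a]
  exact out_landing_glue (n := n) (N' := 4 * M) (t := t) ⟨htr1, htr2⟩ hland hch hXY hLreg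
    hreg hTe' hna P₁ (fun T hT => hEL ▸ hSL T hT) hlo hhi (by omega) he (by push_cast; exact hW) hH hV (by omega)
    (by push_cast; omega)

/-- **The outer landing move to the TOP side at an arbitrary middle target row.** As
`out_landing_move_row`, except that the arc contains the TRANSPOSES of the run `V_{j₀}, …, V_{j₀+d}`
(the pieces of the top side `x₁ = r` over the columns `[t, t + 4M/64]`) and that the approach tube and
the thinned target free space are crossed by the transposed configuration `frameConfig 2 χ` (i.e. `χ`
crosses the vertical approach tube up to beyond `{x₁ = 4M}` vertically and the transposed free space
horizontally). Then `frameConfig 2 χ ∈ extOpenArm n (4M)`: the arm of `χ` lands on the middle half of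
the top side of `∂Λ_{4M}`. [cite: Nolin2008, §4.3 Prop. 12 and §4.4 (arXiv 0711.4948: Prop. 11, Thm. 10, p. 12)] -/
theorem out_landing_move_two {M n k₀ K R₀ : ℕ} (hnM : n ≤ M) {i : ℕ} (hi : i < 6) {χ : SiteConfig (Site 2)}
    (Fo : TrapFencedArm M n k₀ K (frameConfig i χ)) (hmid : -(2 * (M : ℤ)) + R₀ ≤ Fo.z 1 ∧ Fo.z 1 ≤ -(R₀ : ℤ))
    (hR : 4 * Fo.k + 2 ≤ R₀)
    {T₀ : ℤ} {w : ℕ} (hwk : 4 * w ≤ Fo.k) (hk : 4 ≤ Fo.k) (hwin : T₀ ≤ Fo.z 1 ∧ Fo.z 1 < T₀ + w)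
    (hB : frameConfig i χ ∈ triFrameAt (obcnCentre M Fo.k T₀ w) (Fo.k / 2))
    {L ε : ℕ} (hε : 4 * ε ≤ Fo.k) (hL : 2 * Fo.k ≤ L) (hSp : χ ∈ ospokeEvent i M Fo.k T₀ w L ε)
    {r e s a len : ℕ} (hs : 1 ≤ s) (hsr : s ∣ r) (hsr' : s ≤ r) (he : 2 * e ≤ r)
    (harc : χ ∈ eventAll (arc (thinRing r e s) a len))
    {Te : Tube} (hTe : Te ∈ arc (thinRing r e s) a len) (hJ : SpokeMeets i (ospokeTube M Fo.k T₀ w L ε) Te)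
    {t : ℤ} (ht : -(2 * (M : ℤ)) + (4 * M / 16 : ℕ) ≤ t ∧ t ≤ -(M : ℤ) - (4 * M / 16 : ℕ))
    {j₀ d : ℕ} (hSL : ∀ T ∈ vchunks r (-(r : ℤ)) e s j₀ (d + 1), T.swap ∈ arc (thinRing r e s) a len)
    (hlo : -(r : ℤ) + j₀ * s - e ≤ t) (hhi : t + (4 * M / 64 : ℕ) ≤ -(r : ℤ) + (j₀ + d) * s - e)
    {W : ℕ} (hW : (r : ℤ) - 2 * e + W = 4 * M + (4 * M / 16 : ℕ))
    (hH : frameConfig 2 χ ∈ triHCross ((r : ℤ) - 2 * e) t W (4 * M / 64)) (hV : frameConfig 2 χ ∈ otgtV (4 * M) t)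
    (hM : 64 ≤ M) (hkL : 2 * (Fo.k : ℤ) + L ≤ 2 * M) (hr2 : 2 * (M : ℤ) < (r : ℤ) - s - 2 * e) (hr4 : (r : ℤ) + 2 * e ≤ 4 * M) :
    frameConfig 2 χ ∈ extOpenArm n (4 * M) := by
  have hwk' : 4 * (w : ℤ) ≤ Fo.k := by exact_mod_cast hwk
  have hε' : 4 * (ε : ℤ) ≤ Fo.k := by exact_mod_cast hε
  have hR' : 4 * (Fo.k : ℤ) + 2 ≤ R₀ := by exact_mod_cast hR
  have hnM' : (n : ℤ) ≤ M := by exact_mod_cast hnM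
  obtain ⟨hz0, hz1, hz2⟩ := trapO_coord Fo.z_mem
  obtain ⟨hm1, hm2⟩ := hmid
  have ht4 : Fo.z 1 + 4 * Fo.k + 2 ≤ 0 := by omega
  obtain ⟨hland, htr1, htr2⟩ := tgtRow_facts ht
  -- the arc as a nonempty chain with prescribed crossings
  obtain ⟨E, L', hEL⟩ := List.exists_cons_of_ne_nil (List.ne_nil_of_mem hTe)
  have harc' : ∀ T ∈ E :: L', χ ∈ T.event := fun T hT => harc T (hEL ▸ hT)
  have hch : List.IsChain Crosses (E :: L') := hEL ▸ isChain_arc_thinRing hs hsr hsr' a len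
  obtain ⟨X, Y, hXY⟩ := exists_crossings harc'
  have hTe' : Te ∈ E :: L' := hEL ▸ hTe
  have hring : ∀ T ∈ E :: L', T ∈ thinRing r e s := fun T hT => mem_of_mem_arc (hEL ▸ hT : T ∈ arc (thinRing r e s) a len)
  have hLreg : ∀ T ∈ E :: L', T.box ⊆ triAnnulusSet n (4 * M) := fun T hT v hv => by
    have := triNorm_mem_of_mem_thinRing he (hring T hT) hv
    rw [mem_triAnnulusSet]; push_cast; constructor <;> omega
  -- the hook
  have P₁ := out_arm_to_entry hnM hi Fo hwk hk hwin ht4 hB hε hL hSp (hXY Te hTe') hJ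
  -- everything lies in the (transposed) annulus
  have hreg : frameIso i '' ((ospokeTube M Fo.k T₀ w L ε).box ∪ (triAnnSet n (2 * M) ∪ otipBox M (Fo.z 1) Fo.k)) ∪ Te.box ⊆
      frameIso 2 '' (triAnnulusSet n (4 * M) ∪ triOpenBall ![((4 * M : ℕ) : ℤ), t] (4 * M / 8)) := by
    have hann : ∀ v : Site 2, (n : ℤ) ≤ triNorm v → triNorm v ≤ 4 * M →
        v ∈ frameIso 2 '' (triAnnulusSet n (4 * M) ∪ triOpenBall ![((4 * M : ℕ) : ℤ), t] (4 * M / 8)) := fun v h1 h2 => by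
      refine ⟨frameIso 2 v, Or.inl ⟨?_, ?_⟩, frameIso_two_two' v⟩
      · rw [triNorm_frameIso 2 (by norm_num)]; exact h1
      · rw [triNorm_frameIso 2 (by norm_num)]; push_cast; exact h2
    rintro v (⟨u, hu, rfl⟩ | hv)
    · rcases hu with hu | hu | hu
      · have := norm_mem_of_mem_ospokeBox hk hε (T₀ := T₀) (w := w) (L := L) (M := M) (by omega) (by omega) hu
        exact hann _ (by rw [triNorm_frameIso i hi]; omega) (by rw [triNorm_frameIso i hi]; omega)
      · rw [mem_triAnnSet] at hu
        exact hann _ (by rw [triNorm_frameIso i hi]; exact hu.1) (by rw [triNorm_frameIso i hi]; push_cast at hu; omega)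
      · have := norm_mem_of_mem_otipBox (k := Fo.k) (by omega) (by omega) hu
        exact hann _ (by rw [triNorm_frameIso i hi]; omega) (by rw [triNorm_frameIso i hi]; omega)
    · have := hLreg Te hTe' hv
      rw [mem_triAnnulusSet] at this
      push_cast at this
      exact hann v this.1 this.2
  -- glue, transposed
  have hna : triNorm (frameIso i Fo.a) = n := by rw [triNorm_frameIso i hi, Fo.norm_a]
  exact out_landing_glue_two (n := n) (N' := 4 * M) (t := t) ⟨htr1, htr2⟩ hland hch hXY hLreg
    hreg hTe' hna P₁ (fun T hT => hEL ▸ hSL T hT) hlo hhi (by omega) he (by push_cast; exact hW) hH hV (by omega)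
    (by push_cast; omega)

end Literature.Probability.Percolation
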